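import Literature.NumberTheory.EllipticCurves.KatzPAdicLFunctionCMFieldLocalDataThetaProofs
import Literature.NumberTheory.EllipticCurves.KatzPAdicLFunctionCMFieldLocalDataDyadicProofs
import Literature.NumberTheory.NumberFields.UnitDiscriminantUnramified
import Literature.NumberTheory.NumberFields.SqrtNegOneZetaThreeDyadicIndices
import Literature.IUT.LogVolume.RescaledCompletionInvariants
import Mathlib.NumberTheory.NumberField.Discriminant.Different
import HarnessLib

/-!
# Local data of Katz's measure, IV: where `d_w = 0`, and `e(w∣ℓ) = 2` in a quadratic tower
# (the RIGHT side of Hsieh's (d2) at the unit and tame primes of `K′(√d_CM)`)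

PROOF-ONLY sequel of files I–III (no definition, no named fact, no `sorry`). Purpose (route
`BiquadraticEisensteinDescent`, crux stmt-BirchSwinnertonDyer-21341, line `hsieh-lambda`, layer 2; memo
`Cruxes/EisensteinHeartFlatCMInertBadKPrime/INSTANTIATION-L-BIQUADRATIC.md` §ADDENDUM 3): for
`L = K′(x)`, `x² = d_CM`, the different exponent `d_w(L/ℚ)` at the primes of Hsieh's set `D` (above `p`
and above the bad primes of `W`) is computed from two unramifiedness statements and the tame / wild
quadratic formulas of files I–II. This file supplies the unramifiedness statements in the consumer's
currencies:

* §1 `ramificationIdx_eq_one_of_not_dvd_discr` — **Dedekind: `ℓ ∤ d_K ⟹ e(v∣ℓ) = 1`** for every prime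
  `v ∣ ℓ` of a number field `K` (`𝐍(𝒟_{K/ℚ}) = |d_K|`, Mathlib `NumberField.absNorm_differentIdeal`, and
  file I's `d_v = 0 ⟺ e = 1`); `differentExponentAt_eq_zero_of_not_dvd_discr`.
* §2 `isUnramifiedAt_of_sq_eq_of_not_mem` — **Kummer: `L = K(x)`, `x² = t ∈ K` (`t ∈ 𝓞 K`), `2t ∉ w ∩ 𝓞 K`
  ⟹ `L/K` is unramified at `w`** (the tree's Bombieri–Gubler Lemma B.2.6
  `NumberFields.isUnramifiedAt_of_pow_eq_of_valuation_eq_one` at `m = 2`, with the valuation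
  hypotheses read as non-membership); tower consequences `ramificationIdx_int_eq_of_sq_eq_of_not_mem`
  (`e(w∣ℓ) = e(v∣ℓ)`) and `differentExponentAt_eq_of_sq_eq_of_not_mem` (`d_w = d_v`).
* §3 `ramificationIdx_int_le_mul_finrank` — `e(w∣ℓ) ≤ e(v∣ℓ)·[L:K]` (tower multiplicativity
  `Ideal.ramificationIdx_tower` + `Ideal.ramificationIdx_le_finrank`); hence in a quadratic tower over a
  prime unramified in `K`, `e(w∣ℓ) ≤ 2` (`ramificationIdx_int_le_two`).
* §4 THE (d2) RIGHT SIDES at `L = K(x)`, `[L:K] = 2`, `x² = d ∈ ℤ`, for `w ∣ ℓ` with `ℓ ∤ d_K`: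
  `differentExponentAt_eq_zero_of_sq_eq` (`ℓ ∤ 2d` ⟹ `d_w = 0`), `ramificationIdx_eq_two_of_sq_eq`
  (`ℓ ∥ d` ⟹ `e(w∣ℓ) = 2`) and `differentExponentAt_eq_one_of_sq_eq` (`ℓ ∥ d`, `ℓ` odd ⟹ `d_w = 1`),
  `ramificationIdx_eq_two_of_sq_eq_neg_four/eight` and `differentExponentAt_eq_two/three_of_sq_eq_neg_four/eight`
  (`d = −4`: `d_w = 2`; `d = −8`: `d_w = 3` at `w ∣ 2`, `d_K` odd).

References: [cite: NeukirchANT1999, Ch. III §2 Thm. (2.6) and Cor. (2.12) (Dedekind's discriminant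
theorem); Ch. I §8]; [cite: BombieriGubler2006, Lemma B.2.6]; [cite: SerreLocalFields1979, Ch. III §6
Prop. 13]; [cite: Hsieh2014mu, §3.1 (d2)].
-/

set_option autoImplicit false

noncomputable section

open scoped nonZeroDivisors NumberField

namespace Literature.NumberTheory.EllipticCurves

open NumberField IsDedekindDomain

variable {K : Type} [Field K] [NumberField K]

/-! ## §1 Dedekind's discriminant theorem: `ℓ ∤ d_K ⟹ e(v∣ℓ) = 1` -/

/-- **`ℓ ∤ d_K ⟹ d_v = 0`** at every `v ∣ ℓ`: `v ∣ 𝒟` would give `ℓ ∣ 𝐍(v) ∣ 𝐍(𝒟) = |d_K|`.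
[cite: NeukirchANT1999, Ch. III §2 Thm. (2.6) and Cor. (2.12)] -/
theorem differentExponentAt_eq_zero_of_not_dvd_discr {ℓ : ℕ} (hℓ : ℓ.Prime) (v : HeightOneSpectrum (𝓞 K))
    (hv : ((ℓ : ℕ) : 𝓞 K) ∈ v.asIdeal) (hd : ¬ (ℓ : ℤ) ∣ NumberField.discr K) :
    differentExponentAt v = 0 := by
  haveI : Fact ℓ.Prime := ⟨hℓ⟩
  rw [differentExponentAt_eq_multiplicity, Nat.cast_eq_zero, multiplicity_eq_zero]
  intro hdvd
  apply hd
  have h1 : Ideal.absNorm v.asIdeal ∣ Ideal.absNorm (differentIdeal ℤ (𝓞 K)) :=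
    map_dvd Ideal.absNorm hdvd
  rw [NumberField.absNorm_differentIdeal K, Literature.IUT.LogVolume.absNorm_eq_pow_inertiaDeg K ℓ v hv] at h1
  have hf : 0 < v.asIdeal.inertiaDeg ℤ := Ideal.inertiaDeg_pos _ _
  have h2 : (ℓ : ℕ) ∣ (NumberField.discr K).natAbs := (dvd_pow_self ℓ hf.ne').trans h1
  exact Int.natCast_dvd.mpr h2

/-- **Dedekind: `ℓ ∤ d_K ⟹ e(v∣ℓ) = 1`** at every `v ∣ ℓ`. [cite: NeukirchANT1999, Ch. III §2 Cor. (2.12)] -/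
theorem ramificationIdx_eq_one_of_not_dvd_discr {ℓ : ℕ} (hℓ : ℓ.Prime) (v : HeightOneSpectrum (𝓞 K))
    (hv : ((ℓ : ℕ) : 𝓞 K) ∈ v.asIdeal) (hd : ¬ (ℓ : ℤ) ∣ NumberField.discr K) :
    v.asIdeal.ramificationIdx ℤ = 1 :=
  (differentExponentAt_eq_zero_iff_ramificationIdx_eq_one v).mp
    (differentExponentAt_eq_zero_of_not_dvd_discr hℓ v hv hd)

/-! ## §2 Kummer: `K(√t)/K` is unramified away from `2t` -/

section Tower

variable (L : Type) [Field L] [NumberField L] [Algebra K L]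

omit [NumberField K] in
/-- `v(t) = 1` (multiplicative valuation) for an integer `t ∉ v`. [cite: NeukirchANT1999, Ch. I §11] -/
theorem valuation_eq_one_of_not_mem [NumberField K] (v : HeightOneSpectrum (𝓞 K)) {t : 𝓞 K}
    (ht : t ∉ v.asIdeal) : v.valuation K (t : K) = 1 := by
  rw [show (t : K) = algebraMap (𝓞 K) K t from rfl, HeightOneSpectrum.valuation_of_algebraMap]
  exact (HeightOneSpectrum.intValuation_eq_one_iff (v := v)).mpr ht

/-- **Kummer (Bombieri–Gubler B.2.6 at `m = 2`): `L = K(x)`, `x² = t` with `t ∈ 𝓞 K`, and `w` a prime of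
`L` with `2t ∉ w ∩ 𝓞 K` ⟹ `L/K` is unramified at `w`.** [cite: BombieriGubler2006, Lemma B.2.6] -/
theorem isUnramifiedAt_of_sq_eq_of_not_mem {x : L} {t : 𝓞 K} (hgen : Algebra.adjoin K {x} = ⊤)
    (hx : x ^ 2 = algebraMap K L (t : K)) (w : HeightOneSpectrum (𝓞 L))
    (h2t : (2 * t : 𝓞 K) ∉ (w.asIdeal.under (𝓞 K))) : Algebra.IsUnramifiedAt (𝓞 K) w.asIdeal := by
  -- the prime `v = w ∩ 𝓞 K` of `K` below `w`
  have hne : w.asIdeal.under (𝓞 K) ≠ ⊥ := mt Ideal.eq_bot_of_comap_eq_bot w.ne_bot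
  let v : HeightOneSpectrum (𝓞 K) := ⟨w.asIdeal.under (𝓞 K), Ideal.IsPrime.under _ _, hne⟩
  have hprime := v.isPrime
  have ht : (t : 𝓞 K) ∉ v.asIdeal := fun h ↦ h2t (v.asIdeal.mul_mem_left 2 h)
  have h2 : (2 : 𝓞 K) ∉ v.asIdeal := fun h ↦ h2t (v.asIdeal.mul_mem_right t h)
  haveI : w.asIdeal.IsMaximal := w.isMaximal
  refine Literature.NumberTheory.NumberFields.isUnramifiedAt_of_pow_eq_of_valuation_eq_one v two_pos hgen hx
    (valuation_eq_one_of_not_mem v ht) ?_ w.asIdeal rfl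
  have h2' := valuation_eq_one_of_not_mem v h2
  have hc : ((2 : 𝓞 K) : K) = ((2 : ℕ) : K) := by push_cast; rfl
  rwa [hc] at h2'

/-- Tower: if `L/K` is unramified at `w` then **`e(w∣ℓ) = e(v∣ℓ)`** for `v = w ∩ 𝓞 K`
(`Ideal.ramificationIdx_tower`). [cite: NeukirchANT1999, Ch. I §8 (multiplicativity of `e`)] -/
theorem ramificationIdx_int_eq_of_isUnramifiedAt (w : HeightOneSpectrum (𝓞 L)) (v : HeightOneSpectrum (𝓞 K))
    (hwv : w.asIdeal.under (𝓞 K) = v.asIdeal) (hunr : Algebra.IsUnramifiedAt (𝓞 K) w.asIdeal) :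
    w.asIdeal.ramificationIdx ℤ = v.asIdeal.ramificationIdx ℤ := by
  haveI : w.asIdeal.LiesOver v.asIdeal := ⟨hwv.symm⟩
  rw [Ideal.ramificationIdx_tower (R := ℤ) v.asIdeal w.asIdeal, Ideal.ramificationIdx_eq_one_iff.mpr hunr, mul_one]

/-- **`e(w∣ℓ) ≤ e(v∣ℓ)·[L:K]`** for `v = w ∩ 𝓞 K` (tower multiplicativity and `e(w∣v) ≤ [L:K]`).
[cite: NeukirchANT1999, Ch. I §8 (fundamental identity)] -/
theorem ramificationIdx_int_le_mul_finrank (w : HeightOneSpectrum (𝓞 L)) (v : HeightOneSpectrum (𝓞 K))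
    (hwv : w.asIdeal.under (𝓞 K) = v.asIdeal) :
    w.asIdeal.ramificationIdx ℤ ≤ v.asIdeal.ramificationIdx ℤ * Module.finrank K L := by
  haveI : w.asIdeal.LiesOver v.asIdeal := ⟨hwv.symm⟩
  haveI : v.asIdeal.IsMaximal := v.isMaximal
  haveI : w.asIdeal.IsPrime := w.isPrime
  haveI : NoZeroSMulDivisors (𝓞 K) (𝓞 L) := ⟨fun {c x} h ↦ by
    rw [Algebra.smul_def, mul_eq_zero] at h
    rcases h with h | h
    · exact Or.inl (RingOfIntegers.algebraMap.injective K L (by rw [h, map_zero]))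
    · exact Or.inr h⟩
  rw [Ideal.ramificationIdx_tower (R := ℤ) v.asIdeal w.asIdeal]
  gcongr
  rw [← Ideal.ramificationIdx'_eq_ramificationIdx v.asIdeal w.asIdeal v.ne_bot]
  exact Ideal.ramificationIdx_le_finrank (𝓞 L) K L w.asIdeal (p := v.asIdeal)

/-- In a tower `ℚ ⊂ K ⊂ L` with `ℓ ∤ d_K`: **`e(w∣ℓ) ≤ [L:K]`**; for `[L:K] = 2`, `e(w∣ℓ) ≤ 2`.
[cite: NeukirchANT1999, Ch. I §8, Ch. III §2 Cor. (2.12)] -/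
theorem ramificationIdx_int_le_finrank_of_not_dvd_discr {ℓ : ℕ} (hℓ : ℓ.Prime) (w : HeightOneSpectrum (𝓞 L))
    (hw : ((ℓ : ℕ) : 𝓞 L) ∈ w.asIdeal) (hd : ¬ (ℓ : ℤ) ∣ NumberField.discr K) :
    w.asIdeal.ramificationIdx ℤ ≤ Module.finrank K L := by
  have hne : w.asIdeal.under (𝓞 K) ≠ ⊥ := by
    intro h
    have : ((ℓ : ℕ) : 𝓞 K) ∈ w.asIdeal.under (𝓞 K) := by
      rw [Ideal.mem_comap]; simpa using hw
    rw [h, Ideal.mem_bot] at this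
    exact hℓ.ne_zero (by exact_mod_cast this)
  let v : HeightOneSpectrum (𝓞 K) := ⟨w.asIdeal.under (𝓞 K), Ideal.IsPrime.under _ _, hne⟩
  have hv : ((ℓ : ℕ) : 𝓞 K) ∈ v.asIdeal := by
    change _ ∈ w.asIdeal.under (𝓞 K)
    rw [Ideal.mem_comap]; simpa using hw
  have h := ramificationIdx_int_le_mul_finrank L w v rfl
  rwa [ramificationIdx_eq_one_of_not_dvd_discr hℓ v hv hd, one_mul] at h

/-! ## §4 The (d2) right sides in the quadratic tower `L = K(x)`, `x² = d` -/

variable {L}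

omit [NumberField K] [NumberField L] in
/-- Membership transport: for an integer `n`, `n ∈ w ∩ 𝓞 K ⟺ n ∈ w`. [cite: NeukirchANT1999, Ch. I §8] -/
theorem intCast_mem_under_iff (w : HeightOneSpectrum (𝓞 L)) (n : ℤ) :
    ((n : ℤ) : 𝓞 K) ∈ w.asIdeal.under (𝓞 K) ↔ ((n : ℤ) : 𝓞 L) ∈ w.asIdeal := by
  rw [Ideal.mem_comap]; simp

omit [NumberField L] in
/-- For `w ∣ ℓ` and an integer `n` with `ℓ ∤ n`: `n ∉ w`. [cite: NeukirchANT1999, Ch. I §8] -/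
theorem intCast_not_mem_of_not_dvd {ℓ : ℕ} (hℓ : ℓ.Prime) (w : HeightOneSpectrum (𝓞 L))
    (hw : ((ℓ : ℕ) : 𝓞 L) ∈ w.asIdeal) {n : ℤ} (hn : ¬ (ℓ : ℤ) ∣ n) : ((n : ℤ) : 𝓞 L) ∉ w.asIdeal := by
  intro hmem
  apply hn
  have : n ∈ w.asIdeal.under ℤ := by rw [Ideal.mem_comap]; simpa using hmem
  rwa [under_int_eq_span_of_natCast_mem hℓ w hw, Ideal.mem_span_singleton] at this

variable (L)

/-- **UNIT PRIMES: `L = K(x)`, `x² = d ∈ ℤ`, `w ∣ ℓ` with `ℓ ∤ 2d` and `ℓ ∤ d_K` ⟹ `d_w(L/ℚ) = 0`.**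
(`K` unramified at `ℓ` by Dedekind, `L/K` at `w` by Kummer; file I's tower step.)
[cite: NeukirchANT1999, Ch. III §2] [cite: BombieriGubler2006, Lemma B.2.6] -/
theorem differentExponentAt_eq_zero_of_sq_eq {x : L} {d : ℤ} (hgen : Algebra.adjoin K {x} = ⊤)
    (hx : x ^ 2 = (d : L)) {ℓ : ℕ} (hℓ : ℓ.Prime) (w : HeightOneSpectrum (𝓞 L))
    (hw : ((ℓ : ℕ) : 𝓞 L) ∈ w.asIdeal) (h2d : ¬ (ℓ : ℤ) ∣ 2 * d) (hdK : ¬ (ℓ : ℤ) ∣ NumberField.discr K) :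
    differentExponentAt w = 0 := by
  have hne : w.asIdeal.under (𝓞 K) ≠ ⊥ := by
    intro h
    have : ((ℓ : ℤ) : 𝓞 K) ∈ w.asIdeal.under (𝓞 K) := (intCast_mem_under_iff w ℓ).mpr (by simpa using hw)
    rw [h, Ideal.mem_bot] at this
    exact hℓ.ne_zero (by exact_mod_cast this)
  let v : HeightOneSpectrum (𝓞 K) := ⟨w.asIdeal.under (𝓞 K), Ideal.IsPrime.under _ _, hne⟩
  have hv : ((ℓ : ℕ) : 𝓞 K) ∈ v.asIdeal := by
    change ((ℓ : ℕ) : 𝓞 K) ∈ w.asIdeal.under (𝓞 K)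
    rw [Ideal.mem_comap]
    simpa using hw
  have hunr : Algebra.IsUnramifiedAt (𝓞 K) w.asIdeal := by
    refine isUnramifiedAt_of_sq_eq_of_not_mem L (t := ((d : ℤ) : 𝓞 K)) hgen ?_ w ?_
    · rw [hx]; simp
    · rw [show (2 * ((d : ℤ) : 𝓞 K) : 𝓞 K) = ((2 * d : ℤ) : 𝓞 K) by push_cast; ring, intCast_mem_under_iff]
      exact intCast_not_mem_of_not_dvd hℓ w hw h2d
  rw [differentExponentAt_eq_of_isUnramifiedAt L w v rfl hunr]
  exact differentExponentAt_eq_zero_of_not_dvd_discr hℓ v hv hdK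

/-- **TAME PRIMES: `L = K(x)`, `[L:K] ≤ 2`, `x² = d`, `w ∣ ℓ` with `ℓ ∥ d` and `ℓ ∤ d_K` ⟹ `e(w∣ℓ) = 2`.**
[cite: NeukirchANT1999, Ch. I §8, Ch. III §2 Cor. (2.12)] -/
theorem ramificationIdx_eq_two_of_sq_eq {x : L} {d : ℤ} (hx : x ^ 2 = (d : L)) (h2 : Module.finrank K L ≤ 2)
    {ℓ : ℕ} (hℓ : ℓ.Prime) (w : HeightOneSpectrum (𝓞 L)) (hw : ((ℓ : ℕ) : 𝓞 L) ∈ w.asIdeal)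
    (hd : (ℓ : ℤ) ∣ d) (hd2 : ¬ ((ℓ : ℤ) ^ 2) ∣ d) (hdK : ¬ (ℓ : ℤ) ∣ NumberField.discr K) :
    w.asIdeal.ramificationIdx ℤ = 2 :=
  ramificationIdx_eq_two_of_sq_eq_intCast_of_le hx hℓ hd hd2 w hw
    ((ramificationIdx_int_le_finrank_of_not_dvd_discr L hℓ w hw hdK).trans h2)

/-- **… hence `d_w(L/ℚ) = 1` at the odd `ℓ ∥ d`.** [cite: NeukirchANT1999, Ch. III §2 Thm. (2.6)] -/
theorem differentExponentAt_eq_one_of_sq_eq {x : L} {d : ℤ} (hx : x ^ 2 = (d : L)) (h2 : Module.finrank K L ≤ 2)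
    {ℓ : ℕ} (hℓ : ℓ.Prime) (hℓ2 : ℓ ≠ 2) (w : HeightOneSpectrum (𝓞 L)) (hw : ((ℓ : ℕ) : 𝓞 L) ∈ w.asIdeal)
    (hd : (ℓ : ℤ) ∣ d) (hd2 : ¬ ((ℓ : ℤ) ^ 2) ∣ d) (hdK : ¬ (ℓ : ℤ) ∣ NumberField.discr K) :
    differentExponentAt w = 1 := by
  haveI : Fact ℓ.Prime := ⟨hℓ⟩
  exact differentExponentAt_eq_one_of_ramificationIdx_eq_two hℓ2 w hw
    (ramificationIdx_eq_two_of_sq_eq L hx h2 hℓ w hw hd hd2 hdK)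

/-- **DYADIC, `d = −4`: `x² = −4` in `L`, `[L:K] ≤ 2`, `d_K` odd ⟹ `e(w∣2) = 2` at `w ∣ 2`** (`i = x/2 ∈ L`).
[cite: NeukirchANT1999, Ch. I §8] -/
theorem ramificationIdx_eq_two_of_sq_eq_neg_four {x : L} (hx : x ^ 2 = -4) (h2 : Module.finrank K L ≤ 2)
    (w : HeightOneSpectrum (𝓞 L)) (hw : ((2 : ℕ) : 𝓞 L) ∈ w.asIdeal) (hdK : ¬ (2 : ℤ) ∣ NumberField.discr K) :
    w.asIdeal.ramificationIdx ℤ = 2 := by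
  have hi : (x / 2) ^ 2 = -1 := by rw [div_pow, hx]; norm_num
  have h2e := Literature.NumberTheory.NumberFields.two_dvd_ramificationIdx_of_sq_eq_neg_one hi w hw
  have hle := (ramificationIdx_int_le_finrank_of_not_dvd_discr L Nat.prime_two w hw (by exact_mod_cast hdK)).trans h2
  have hpos : 0 < w.asIdeal.ramificationIdx ℤ := Ideal.ramificationIdx_pos _ _
  obtain ⟨k, hk⟩ := h2e
  omega

/-- **… hence `d_w(L/ℚ) = 2`** (`d = −4`, `w ∣ 2`, `d_K` odd). [cite: SerreLocalFields1979, Ch. III §6 Prop. 13] -/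
theorem differentExponentAt_eq_two_of_sq_eq_neg_four {x : L} (hx : x ^ 2 = -4) (h2 : Module.finrank K L ≤ 2)
    (w : HeightOneSpectrum (𝓞 L)) (hw : ((2 : ℕ) : 𝓞 L) ∈ w.asIdeal) (hdK : ¬ (2 : ℤ) ∣ NumberField.discr K) :
    differentExponentAt w = 2 := by
  have hi : (x / 2) ^ 2 = -1 := by rw [div_pow, hx]; norm_num
  exact differentExponentAt_eq_two_of_sq_eq_neg_one hi w hw (ramificationIdx_eq_two_of_sq_eq_neg_four L hx h2 w hw hdK)

/-- **DYADIC, `d = −8`: `x² = −8` in `L`, `[L:K] ≤ 2`, `d_K` odd ⟹ `e(w∣2) = 2` at `w ∣ 2`** (`√−2 = x/2 ∈ L`).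
[cite: NeukirchANT1999, Ch. I §8] -/
theorem ramificationIdx_eq_two_of_sq_eq_neg_eight {x : L} (hx : x ^ 2 = -8) (h2 : Module.finrank K L ≤ 2)
    (w : HeightOneSpectrum (𝓞 L)) (hw : ((2 : ℕ) : 𝓞 L) ∈ w.asIdeal) (hdK : ¬ (2 : ℤ) ∣ NumberField.discr K) :
    w.asIdeal.ramificationIdx ℤ = 2 := by
  have hy : (x / 2) ^ 2 = ((-2 : ℤ) : L) := by rw [div_pow, hx]; norm_num
  exact ramificationIdx_eq_two_of_sq_eq_intCast_of_le hy Nat.prime_two ⟨-1, by norm_num⟩ (by decide) w hw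
    ((ramificationIdx_int_le_finrank_of_not_dvd_discr L Nat.prime_two w hw (by exact_mod_cast hdK)).trans h2)

/-- **… hence `d_w(L/ℚ) = 3`** (`d = −8`, `w ∣ 2`, `d_K` odd). [cite: SerreLocalFields1979, Ch. III §6 Prop. 13] -/
theorem differentExponentAt_eq_three_of_sq_eq_neg_eight {x : L} (hx : x ^ 2 = -8) (h2 : Module.finrank K L ≤ 2)
    (w : HeightOneSpectrum (𝓞 L)) (hw : ((2 : ℕ) : 𝓞 L) ∈ w.asIdeal) (hdK : ¬ (2 : ℤ) ∣ NumberField.discr K) :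
    differentExponentAt w = 3 := by
  have hy : (x / 2) ^ 2 = -2 := by rw [div_pow, hx]; norm_num
  exact differentExponentAt_eq_three_of_sq_eq_neg_two hy w hw
    (ramificationIdx_eq_two_of_sq_eq_neg_eight L hx h2 w hw hdK)

end Tower

end Literature.NumberTheory.EllipticCurves

end
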